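/-
Copyright (c) 2026 the pub-hodgecm-mathlib formalisation cell (harness21).  Prover seat hodgecm-mathlib-LH4-p08 (g11) (valve hand), Track B «K2-LIT»,
#184♮ = hLiu418 = `stmt-HodgeConjecture-24832`; socket #41, KIND W — (KW-arch-hBL) brick (3d-i), the (0,2) twin in the GENERIC picture alphabet (KW desk
F0P2-p08 (g4) 01:46:55Z (ii)).  THEOREMS ONLY (no `def`, no `instance`, no notation, no named-fact hypothesis, no `sorry`).
-/
import Summits.HodgeConjecture.HodgeConjecture.Theorems.K2LiuKindWArchWhittakerGrowthAtOnePic   -- ★ p864233 the engine (positive definite, generic picture)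
import HarnessLib

/-!
# Crux `HLiu418`, socket #41, KIND W — `K2LiuKindWArchWhittakerGrowthAtOnePicNegDef`: GROWTH CONSTANTS UNIFORM IN THE INDEX AND IN `g`, NEGATIVE DEFINITE
# FRAMED INDEX, GENERIC PICTURE PREDICATE

Cell `hodgecm-mathlib`, crux item hLiu418 = `stmt-HodgeConjecture-24832` (helper lane `--supports … --as helper`, count-neutral), route of record `HCCMUnconditional`;
squad K2 ∕ K2Liu, socket #41, KIND W, (iii-arch) block letter `hBL`, brick (3d-i).  ★ `K2LiuKindWArchWhittakerGrowthAtOnePic.exists_growth_constants_of_posDef_pic`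
is the positive definite head in the generic alphabet `(k) (hk) (Pic) {B C} (hx) (hKpic)`; THIS FILE is its (0,2) twin **`exists_growth_constants_of_negDef_pic`** —
the SAME conclusion with `(-hidx).PosDef` in both slots, in the ORIGINAL letters — so that K2E3-p11 (g10)'s (3d-iv) `stabUniform_of_atOne` eats all sign cases
through ONE `hAtOne` slot (the `evalAt … Q` heads ★ `K2LiuKindWArchWhittakerGrowthAtOne` are corollaries).  PROOF: the block-sign mirror `θ y = D·y·D` (★ p863756
§2): the engine at the mirrored frame `θx` and the mirrored picture `Pic′ s G := Pic s (G∘θ)` (bridge ★ `kPicture_conjBlockSign Pic hKpic`), family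
`Ew hidx g := Ew′ (−hidx) (θ g)`, formula via `(F∘θ)∘θ = F` and `r ↦ −r` on the chart, growth face via the transport `(X₀, R) ↦ (−X₀, −R)` of Siegel-form
decompositions (`(−R)⁻¹ = −R⁻¹`, `‖det(−R)‖ = ‖det R‖`, `(−R)(−h₁)(−R) = −(R h₁ R)`).
[Shimura1997, §16.4, §18.4] [KudlaRallis1994, §1].
HONEST LABEL.  Count-neutral helper, closes no socket: `HC_CM` is proved only modulo the 7 printed citations (2 remaining named inputs: hLiu418 =
`stmt-HodgeConjecture-24832`, h413 = `stmt-HodgeConjecture-24833`) until rung 0 closes.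
-/

set_option autoImplicit false
set_option linter.dupNamespace false -- the mandated namespace repeats `HodgeConjecture.HodgeConjecture`

noncomputable section

open Complex Matrix MeasureTheory
open scoped ComplexConjugate ComplexOrder
open Literature.NumberTheory.ModularForms.SiegelUpperHalfSpace (moeb)

namespace Summit.HodgeConjecture.HodgeConjecture.Cruxes.HLiu418.K2LiuKindWArchWhittakerGrowthAtOnePicNegDef

open Summit.HodgeConjecture.HodgeConjecture.Cruxes.HLiu418.K2LiuArchInducedTubeDefs
open Summit.HodgeConjecture.HodgeConjecture.Cruxes.HLiu418.K2LiuU22CompactPictureDefs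
open Summit.HodgeConjecture.HodgeConjecture.Cruxes.HLiu418.K2LiuKindWArchWhittakerLetterNegDef
open Summit.HodgeConjecture.HodgeConjecture.Cruxes.HLiu418.K2LiuKindWArchWhittakerGrowthAtOnePic (exists_growth_constants_of_posDef_pic)

/-- **GROWTH CONSTANTS UNIFORM IN THE INDEX AND IN `g` — NEGATIVE DEFINITE FRAMED INDEX (signature (0,2)), GENERIC PICTURE PREDICATE.**  ★
`exists_growth_constants_of_posDef_pic`'s binders and conclusion with `(-hidx).PosDef` in both slots, in the ORIGINAL letters (block-sign mirror: family
`Ew hidx g := Ew′ (−hidx) (θg)` at the mirrored picture `Pic′ s G := Pic s (G∘θ)`, Siegel-form decompositions transported by `(X₀, R) ↦ (−X₀, −R)`).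
[cite: Shimura1997, §16.4, §18.4] [cite: KudlaRallis1994, §1] -/
theorem exists_growth_constants_of_negDef_pic {k : ℤ} (hk : -2 ≤ k)
    (Pic : ℂ → (Matrix (Fin 2 ⊕ Fin 2) (Fin 2 ⊕ Fin 2) ℂ → ℂ) → Prop)
    {B C : Matrix (Fin 2) (Fin 2) ℂ}
    (hx : (fromBlocks 0 B C 0 : Matrix (Fin 2 ⊕ Fin 2) (Fin 2 ⊕ Fin 2) ℂ)ᴴ * Matrix.J (Fin 2) ℂ * (fromBlocks 0 B C 0 : Matrix (Fin 2 ⊕ Fin 2) (Fin 2 ⊕ Fin 2) ℂ) =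
      Matrix.J (Fin 2) ℂ)
    (hKpic : ∀ k₀ : Matrix (Fin 2 ⊕ Fin 2) (Fin 2 ⊕ Fin 2) ℂ, k₀ᴴ * Matrix.J (Fin 2) ℂ * k₀ = Matrix.J (Fin 2) ℂ →
      moeb k₀ (I • (1 : Matrix (Fin 2) (Fin 2) ℂ)) = I • 1 →
      ∃ P : MvPolynomial (((Fin 2 ⊕ Fin 2) × (Fin 2 ⊕ Fin 2)) ⊕ ((Fin 2 ⊕ Fin 2) × (Fin 2 ⊕ Fin 2))) ℂ,
        ∀ (s : ℂ) (F : Matrix (Fin 2 ⊕ Fin 2) (Fin 2 ⊕ Fin 2) ℂ → ℂ), IsArchSiegelSection (fun z : ℂ => (conj z / ((‖z‖ : ℝ) : ℂ)) ^ k) s F →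
          Pic s F →
          ∀ u : Matrix (Fin 2 ⊕ Fin 2) (Fin 2 ⊕ Fin 2) ℂ, uᴴ * Matrix.J (Fin 2) ℂ * u = Matrix.J (Fin 2) ℂ → moeb u (I • (1 : Matrix (Fin 2) (Fin 2) ℂ)) = I • 1 →
            F (u * k₀) = MvPolynomial.eval (Sum.elim (fun pq => u pq.1 pq.2) (fun pq => conj (u pq.1 pq.2))) P) :
    ∃ Ew : Matrix (Fin 2) (Fin 2) ℂ → Matrix (Fin 2 ⊕ Fin 2) (Fin 2 ⊕ Fin 2) ℂ → ℂ → ℂ,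
      (∀ hidx : Matrix (Fin 2) (Fin 2) ℂ, (-hidx).PosDef → ∀ eb : Matrix (Fin 2) (Fin 2) ℂ → ℂ, (∀ b, eb b = cexp (-(2 * Real.pi * I) * (hidx * b).trace)) →
        ∀ g : Matrix (Fin 2 ⊕ Fin 2) (Fin 2 ⊕ Fin 2) ℂ, gᴴ * Matrix.J (Fin 2) ℂ * g = Matrix.J (Fin 2) ℂ →
        DifferentiableOn ℂ (Ew hidx g) {s : ℂ | 0 < s.re} ∧
        ∃ s₀ : ℝ, ∀ s : ℂ, s₀ < s.re →
          ∀ F : Matrix (Fin 2 ⊕ Fin 2) (Fin 2 ⊕ Fin 2) ℂ → ℂ, IsArchSiegelSection (fun z : ℂ => (conj z / ((‖z‖ : ℝ) : ℂ)) ^ k) s F → Pic s F →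
            ∫ r : Fin 2 → Fin 2 → ℝ, F ((fromBlocks 0 B C 0 : Matrix (Fin 2 ⊕ Fin 2) (Fin 2 ⊕ Fin 2) ℂ) * fromBlocks 1 (hermOfReal r) 0 1 * g) * eb (hermOfReal r) =
              Ew hidx g s) ∧
      ∀ z : ℂ, 0 < z.re → ∃ Cg cg N N' r : ℝ, 0 ≤ Cg ∧ 0 < cg ∧ 0 ≤ N ∧ 0 ≤ N' ∧ 0 < r ∧
        ∀ hidx : Matrix (Fin 2) (Fin 2) ℂ, (-hidx).PosDef → ∀ eb : Matrix (Fin 2) (Fin 2) ℂ → ℂ, (∀ b, eb b = cexp (-(2 * Real.pi * I) * (hidx * b).trace)) →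
        ∀ g : Matrix (Fin 2 ⊕ Fin 2) (Fin 2 ⊕ Fin 2) ℂ, gᴴ * Matrix.J (Fin 2) ℂ * g = Matrix.J (Fin 2) ℂ →
          ∀ (X₀ R : Matrix (Fin 2) (Fin 2) ℂ), X₀ᴴ = X₀ → Rᴴ = R → IsUnit R.det →
            (fromBlocks C 0 0 (-B) : Matrix (Fin 2 ⊕ Fin 2) (Fin 2 ⊕ Fin 2) ℂ) * g = fromBlocks 1 X₀ 0 1 * fromBlocks R 0 0 R⁻¹ →
            ∀ s : ℂ, dist s z < r →
              ‖Ew hidx g s‖ ≤ Cg * ‖R.det‖ ^ (2 - 2 * s.re) * Real.exp (-(cg * ∑ a, ∑ b, ‖(R * ((C⁻¹)ᴴ * hidx * C⁻¹) * R) a b‖)) *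
                (1 + ∑ a, ∑ b, ‖(R * ((C⁻¹)ᴴ * hidx * C⁻¹) * R) a b‖) ^ N * (1 + ‖(R * ((C⁻¹)ᴴ * hidx * C⁻¹) * R).det‖ ^ (-N')) := by
  -- the mirrored frame `θx`, the mirrored picture and bridge (as in ★ p863756 §3); the engine's family `Ew′` there
  have hx' : (fromBlocks 0 (-B) (-C) 0 : Matrix (Fin 2 ⊕ Fin 2) (Fin 2 ⊕ Fin 2) ℂ)ᴴ * Matrix.J (Fin 2) ℂ *
      (fromBlocks 0 (-B) (-C) 0 : Matrix (Fin 2 ⊕ Fin 2) (Fin 2 ⊕ Fin 2) ℂ) = Matrix.J (Fin 2) ℂ := by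
    have h := conjBlockSign_mem_UJ hx
    rwa [blockSign_mul_antidiag_mul_blockSign] at h
  obtain ⟨Ew, hEw, hgr⟩ := exists_growth_constants_of_posDef_pic hk
    (fun (s : ℂ) (G : Matrix (Fin 2 ⊕ Fin 2) (Fin 2 ⊕ Fin 2) ℂ → ℂ) =>
      Pic s (fun y => G ((fromBlocks 1 0 0 (-1) : Matrix (Fin 2 ⊕ Fin 2) (Fin 2 ⊕ Fin 2) ℂ) * y * fromBlocks 1 0 0 (-1))))
    hx' (kPicture_conjBlockSign (k := k) Pic hKpic)
  -- the family: `Ew′ (−hidx) (θ g)`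
  refine ⟨fun hidx g => Ew (-hidx) ((fromBlocks 1 0 0 (-1) : Matrix (Fin 2 ⊕ Fin 2) (Fin 2 ⊕ Fin 2) ℂ) * g * fromBlocks 1 0 0 (-1)),
    fun hidx hneg eb heb g hg => ?_, fun z hz => ?_⟩
  · -- holomorphy and the formula: `F = (F∘θ)∘θ`, `F∘θ` is flat with the mirrored picture, then `r ↦ −r` on the chart
    beta_reduce
    have heb' : ∀ b : Matrix (Fin 2) (Fin 2) ℂ, (fun b' : Matrix (Fin 2) (Fin 2) ℂ => eb (-b')) b = cexp (-(2 * Real.pi * I) * (-hidx * b).trace) := by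
      intro b
      simp only [heb, Matrix.neg_mul, Matrix.mul_neg]
    obtain ⟨hhol, s₀, hform⟩ := hEw (-hidx) hneg _ heb' _ (conjBlockSign_mem_UJ hg)
    refine ⟨hhol, s₀, fun s hs F hF hFQ => ?_⟩
    have hfun : (fun y : Matrix (Fin 2 ⊕ Fin 2) (Fin 2 ⊕ Fin 2) ℂ =>
        F ((fromBlocks 1 0 0 (-1) : Matrix (Fin 2 ⊕ Fin 2) (Fin 2 ⊕ Fin 2) ℂ) *
          ((fromBlocks 1 0 0 (-1) : Matrix (Fin 2 ⊕ Fin 2) (Fin 2 ⊕ Fin 2) ℂ) * y * fromBlocks 1 0 0 (-1)) * fromBlocks 1 0 0 (-1))) = F :=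
      funext fun y => by simp only [Matrix.mul_assoc, blockSign_mul_blockSign_mul, blockSign_mul_blockSign, Matrix.mul_one]
    have key := hform s hs (fun y => F ((fromBlocks 1 0 0 (-1) : Matrix (Fin 2 ⊕ Fin 2) (Fin 2 ⊕ Fin 2) ℂ) * y * fromBlocks 1 0 0 (-1)))
      (isArchSiegelSection_conjBlockSign hF)
      (by
        show Pic s (fun y : Matrix (Fin 2 ⊕ Fin 2) (Fin 2 ⊕ Fin 2) ℂ =>
          F ((fromBlocks 1 0 0 (-1) : Matrix (Fin 2 ⊕ Fin 2) (Fin 2 ⊕ Fin 2) ℂ) *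
            ((fromBlocks 1 0 0 (-1) : Matrix (Fin 2 ⊕ Fin 2) (Fin 2 ⊕ Fin 2) ℂ) * y * fromBlocks 1 0 0 (-1)) * fromBlocks 1 0 0 (-1)))
        rw [hfun]; exact hFQ)
    rw [← key]
    refine Eq.trans ?_ (integral_neg_eq_self _ volume)
    congr 1
    funext r
    simp only [hermOfReal_neg, neg_neg]
    rw [← blockSign_mul_antidiag_mul_blockSign B C, ← blockSign_mul_transl_mul_blockSign (hermOfReal r)]
    simp only [Matrix.mul_assoc, blockSign_mul_blockSign_mul, blockSign_mul_blockSign, Matrix.mul_one]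
  · -- the uniform growth: transport the Siegel-form decomposition `(X₀, R)` of `diag(C,−B)·g` to `(−X₀, −R)` of `diag(−C,B)·θg`
    obtain ⟨Cg, cg, N, N', r, hCg, hcg, hN, hN', hr, hface⟩ := hgr z hz
    refine ⟨Cg, cg, N, N', r, hCg, hcg, hN, hN', hr, fun hidx hneg eb heb g hg X₀ R hX₀ hR hRu hdec s hs => ?_⟩
    beta_reduce
    have heb' : ∀ b : Matrix (Fin 2) (Fin 2) ℂ, (fun b' : Matrix (Fin 2) (Fin 2) ℂ => eb (-b')) b = cexp (-(2 * Real.pi * I) * (-hidx * b).trace) := by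
      intro b
      simp only [heb, Matrix.neg_mul, Matrix.mul_neg]
    obtain ⟨-, hBC⟩ := K2LiuArchBlockOfFrame.antidiag_letters hx
    have hCu : IsUnit C.det := isUnit_iff_ne_zero.2 (Matrix.isUnit_det_of_left_inverse hBC).ne_zero
    have hCiC : C⁻¹ * C = 1 := Matrix.nonsing_inv_mul C hCu
    have hRneg : (-R)⁻¹ = -R⁻¹ := Matrix.inv_eq_left_inv (by rw [neg_mul_neg, Matrix.nonsing_inv_mul R hRu])
    have hdetnegR : (-R).det = R.det := by
      rw [Matrix.det_neg, Fintype.card_fin]; norm_num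
    have hX₀' : (-X₀)ᴴ = -X₀ := by rw [conjTranspose_neg, hX₀]
    have hR' : (-R)ᴴ = -R := by rw [conjTranspose_neg, hR]
    have hRu' : IsUnit (-R).det := by rw [hdetnegR]; exact hRu
    -- the transported decomposition
    have e1 : (fromBlocks (-C) 0 0 (-(-B)) : Matrix (Fin 2 ⊕ Fin 2) (Fin 2 ⊕ Fin 2) ℂ) * (fromBlocks 1 0 0 (-1) : Matrix (Fin 2 ⊕ Fin 2) (Fin 2 ⊕ Fin 2) ℂ) =
        -((fromBlocks 1 0 0 (-1) : Matrix (Fin 2 ⊕ Fin 2) (Fin 2 ⊕ Fin 2) ℂ) * fromBlocks C 0 0 (-B)) := by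
      rw [fromBlocks_multiply, fromBlocks_multiply, fromBlocks_neg]
      simp only [Matrix.mul_zero, Matrix.zero_mul, add_zero, zero_add, Matrix.one_mul, Matrix.mul_one, Matrix.mul_neg, Matrix.neg_mul, neg_neg,
        neg_zero]
    have e2 : (fromBlocks 1 0 0 (-1) : Matrix (Fin 2 ⊕ Fin 2) (Fin 2 ⊕ Fin 2) ℂ) * fromBlocks 1 X₀ 0 1 * fromBlocks R 0 0 R⁻¹ =
        fromBlocks 1 (-X₀) 0 1 * fromBlocks R 0 0 R⁻¹ * (fromBlocks 1 0 0 (-1) : Matrix (Fin 2 ⊕ Fin 2) (Fin 2 ⊕ Fin 2) ℂ) := by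
      rw [fromBlocks_multiply, fromBlocks_multiply, fromBlocks_multiply, fromBlocks_multiply]
      simp only [Matrix.mul_zero, Matrix.zero_mul, add_zero, zero_add, Matrix.one_mul, Matrix.mul_one, Matrix.mul_neg, Matrix.neg_mul, neg_neg]
    have hdec' : (fromBlocks (-C) 0 0 (-(-B)) : Matrix (Fin 2 ⊕ Fin 2) (Fin 2 ⊕ Fin 2) ℂ) *
        ((fromBlocks 1 0 0 (-1) : Matrix (Fin 2 ⊕ Fin 2) (Fin 2 ⊕ Fin 2) ℂ) * g * fromBlocks 1 0 0 (-1)) =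
        fromBlocks 1 (-X₀) 0 1 * fromBlocks (-R) 0 0 (-R)⁻¹ := by
      calc (fromBlocks (-C) 0 0 (-(-B)) : Matrix (Fin 2 ⊕ Fin 2) (Fin 2 ⊕ Fin 2) ℂ) *
            ((fromBlocks 1 0 0 (-1) : Matrix (Fin 2 ⊕ Fin 2) (Fin 2 ⊕ Fin 2) ℂ) * g * fromBlocks 1 0 0 (-1))
          = -((fromBlocks 1 0 0 (-1) : Matrix (Fin 2 ⊕ Fin 2) (Fin 2 ⊕ Fin 2) ℂ) * ((fromBlocks C 0 0 (-B) : Matrix (Fin 2 ⊕ Fin 2) (Fin 2 ⊕ Fin 2) ℂ) * g) *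
              fromBlocks 1 0 0 (-1)) := by
            rw [← Matrix.mul_assoc, ← Matrix.mul_assoc, e1]
            simp only [Matrix.neg_mul, Matrix.mul_assoc]
        _ = -(fromBlocks 1 (-X₀) 0 1 * fromBlocks R 0 0 R⁻¹ *
              ((fromBlocks 1 0 0 (-1) : Matrix (Fin 2 ⊕ Fin 2) (Fin 2 ⊕ Fin 2) ℂ) * fromBlocks 1 0 0 (-1))) := by
            rw [hdec, ← Matrix.mul_assoc, e2]
            simp only [Matrix.mul_assoc]
        _ = fromBlocks 1 (-X₀) 0 1 * fromBlocks (-R) 0 0 (-R)⁻¹ := by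
            rw [blockSign_mul_blockSign, Matrix.mul_one, hRneg, ← Matrix.mul_neg, fromBlocks_neg, neg_zero]
    have hb := hface (-hidx) hneg _ heb' _ (conjBlockSign_mem_UJ hg) (-X₀) (-R) hX₀' hR' hRu' hdec' s hs
    -- `hidx ↦ −hidx`, `C ↦ −C`, `R ↦ −R`: entrywise norms and `‖det‖` are unchanged
    have hCneg : (-C)⁻¹ = -C⁻¹ := Matrix.inv_eq_left_inv (by rw [neg_mul_neg, hCiC])
    have hneg1 : (-R) * (((-C)⁻¹)ᴴ * (-hidx) * (-C)⁻¹) * (-R) = -(R * ((C⁻¹)ᴴ * hidx * C⁻¹) * R) := by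
      rw [hCneg, conjTranspose_neg]
      simp only [Matrix.neg_mul, Matrix.mul_neg, neg_neg]
    rw [hneg1, hdetnegR, Matrix.det_neg, norm_mul, norm_pow, norm_neg, norm_one, one_pow, one_mul] at hb
    simpa only [Matrix.neg_apply, norm_neg] using hb

end Summit.HodgeConjecture.HodgeConjecture.Cruxes.HLiu418.K2LiuKindWArchWhittakerGrowthAtOnePicNegDef

end
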